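import Mathlib
import HarnessLib
import Summits.HubbardSuperconductivity.HubbardSuperconductivity.Theses.LiebTwin
import Summits.HubbardSuperconductivity.HubbardSuperconductivity.Theorems.LiebTwinNoOnsiteODLROStubZeroTemperatureFalkBruch
import Literature.MathematicalPhysics.QuantumLattice.FreeFermiGasPairGramBounds

/-!
# Crux `NoOnsiteODLRO` (stmt-HubbardSuperconductivity-0933), line `registered` (birth) — the
# prefactor-uniform zero-temperature Falk–Bruch engine at fixed side

At a fixed even side `L ≥ 3`, for a normalised ground state `φ` of `H = hubbardTorus 2 L 1 U` in the
sector `(n, S^z = 0)` (`2 ≤ n`) and ANY prefactor `A ≥ 0`: if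
`|⟨v, P_s φ⟩|² ≤ A · (Re⟨v, H v⟩ + (U - E_n) ‖v‖²)` for every `v` in the pair-removed sector `(n-2, 0)`,
then `S³ ≤ 4 c₀² · A² · L⁴`, `S = Re⟨φ, P_sᴴ P_s φ⟩`, `c₀ = Σ_{e ∈ {0} ∪ unitSteps} 2‖s'(e)/√2‖` the crude
a-priori constant of the extended-`s` pair field (`c₀² = 32`). With `A = C L²` this is the registered
engine stub (`S³ ≤ 128 C² L⁸`); with `A = ε L⁴` it feeds the little-`o` glue. Proof: test the bound on
`v := P_s φ`; the enslaved-A1g identity `H P_s - P_s H + U P_s = 2 P_{s'}` and `H φ = E_n φ` turn the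
bracket into `2 Re⟨P_s φ, P_{s'} φ⟩ ≤ 2 √S · c₀ L²` (Cauchy–Schwarz, `‖P_{s'} φ‖ ≤ c₀ L²`).
Falk–Bruch 1969; Dyson–Lieb–Simon 1978 Thm 3.1; Pitaevskii–Stringari 1991 (T = 0 form).

Consequence (`NoOnsiteODLRO_of_littleO_susceptibility`): the crux already follows from the WEAKEST form of
the line's open stub — the `U`-shifted on-site pair-removal susceptibility `χ_L = ⟨P_sψ_L, K₋⁻¹ P_sψ_L⟩`
(`K₋ = H - E_N + U ≥ 0` on the pair-removed sector, Yang) being `o(L⁴)` along even `L` — which, given a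
strict pair chemical-potential window, is equivalent to the crux itself (lead analysis, cycle 1): the line
`registered` reduces `NoOnsiteODLRO` to ANY sub-`L⁴` bound on that susceptibility, and to nothing less.
-/

noncomputable section

namespace Summit.HubbardSuperconductivity.NoOnsiteODLRO.Birth

open Matrix Finset Filter
open scoped ComplexOrder
open Literature.Probability.LatticeModels Literature.MathematicalPhysics.QuantumLattice

/-- **A-priori bound** `Re⟨Δ_g ψ, Δ_g ψ⟩ ≤ (c_g L²)² · Re⟨ψ, ψ⟩` (the dot-product form of the landed
`norm_toLp_pairField_mulVec_le_mul_sq`). Scalapino, Phys. Rep. 250 (1995) 329, §2. [folklore] -/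
theorem re_star_pairField_mulVec_self_le (g : Site 2 → ℝ) (L : ℕ) [NeZero L]
    (ψ : Fock (Orb (FermionTorus 2 L))) :
    (star (pairField g L *ᵥ ψ) ⬝ᵥ (pairField g L *ᵥ ψ)).re ≤
      ((∑ e ∈ insert (0 : Site 2) unitSteps, ‖((g e / Real.sqrt 2 : ℝ) : ℂ)‖ * 2) * (L : ℝ) ^ 2) ^ 2 * (star ψ ⬝ᵥ ψ).re := by
  rw [← norm_toLp_sq_eq_re, ← norm_toLp_sq_eq_re, ← mul_pow]
  exact pow_le_pow_left₀ (norm_nonneg _) (norm_toLp_pairField_mulVec_le_mul_sq g L ψ) 2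

/-- **The prefactor-uniform engine at fixed side.** For `3 ≤ L`, `2 ≤ n`, a normalised ground state
`φ` of `hubbardTorus 2 L 1 U` in the sector `(n, 0)` and any `A ≥ 0`: the infrared bound with prefactor
`A` on the pair-removed sector `(n - 2, 0)` implies `S³ ≤ 4 c₀² A² L⁴` (`c₀ = Σ_{e ∈ {0} ∪ unitSteps} 2‖s'(e)/√2‖`, the crude a-priori constant).
Falk–Bruch, Phys. Rev. 180 (1969) 442; Dyson–Lieb–Simon, J. Stat. Phys. 18 (1978) 335, Thm 3.1;
Pitaevskii–Stringari, J. Low Temp. Phys. 85 (1991) 377; Zhang, PRB 42 (1990) 1012; Yang, PRL 63 (1989)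
2144. [folklore] -/
theorem falkBruch_fixedSide {L : ℕ} [NeZero L] (hL : 3 ≤ L) (U : ℝ) {n : ℕ} (hn : 2 ≤ n)
    {φ : Fock (Orb (FermionTorus 2 L))} (hφ1 : star φ ⬝ᵥ φ = 1)
    (hGS : IsGroundStateInSector (hubbardTorus 2 L 1 U) n 0 φ) {A : ℝ} (hA : 0 ≤ A)
    (hIR : ∀ v : Fock (Orb (FermionTorus 2 L)), v ∈ szSector (Λ := FermionTorus 2 L) (n - 2) 0 →
      ‖star v ⬝ᵥ ((pairField sWave L) *ᵥ φ)‖ ^ 2 ≤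
        A * ((expect (hubbardTorus 2 L 1 U) v).re +
          (U - (hubbardTorus 2 L 1 U).minEnergyOn (szSector (Λ := FermionTorus 2 L) n 0)) *
            (star v ⬝ᵥ v).re)) :
    (expect ((pairField sWave L)ᴴ * pairField sWave L) φ).re ^ 3 ≤
      4 * (∑ e ∈ insert (0 : Site 2) unitSteps, ‖((extendedSWave e / Real.sqrt 2 : ℝ) : ℂ)‖ * 2) ^ 2 * A ^ 2 * (L : ℝ) ^ 4 := by
  obtain ⟨hmem, _hne, hHφ⟩ := hGS
  rw [PosSemidefTrace.expect_conjTranspose_mul]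
  set H := hubbardTorus 2 L 1 U with hHdef
  set E : ℝ := H.minEnergyOn (szSector (Λ := FermionTorus 2 L) n 0) with hEdef
  set φ' := pairField sWave L *ᵥ φ with hφ'def
  set w := pairField extendedSWave L *ᵥ φ with hwdef
  set c₀ : ℝ := (∑ e ∈ insert (0 : Site 2) unitSteps, ‖((extendedSWave e / Real.sqrt 2 : ℝ) : ℂ)‖ * 2) with hc₀def
  have hc₀ : 0 ≤ c₀ := localPairNormBound_nonneg _
  -- (a) `P_s φ ∈ szSector (n - 2) 0`
  have hφ'mem : φ' ∈ szSector (Λ := FermionTorus 2 L) (n - 2) 0 := by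
    have h := Summit.HubbardSuperconductivity.HubbardSuperconductivity.Theorems.WcbcsSsbToTorusLRO.pairFieldAt_mulVec_mem_szSector
      sWave (0 : TorusSite 2 L) hn hmem
    rwa [pairFieldAt_zero] at h
  -- (b) the enslaved-A1g identity applied to `φ`
  have hid := Summit.HubbardSuperconductivity.EnslavedA1g.enslavedA1gIdentity_proof L (by omega) U
  have h2v : (2 : ℂ) • w = H *ᵥ φ' - ((E : ℝ) : ℂ) • φ' + (U : ℂ) • φ' := by
    have h := congrArg (fun M => M *ᵥ φ) hid
    rw [smul_mulVec, add_mulVec, sub_mulVec, ← mulVec_mulVec, ← mulVec_mulVec, hHφ, mulVec_smul,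
      smul_mulVec] at h
    exact h
  have hbr : (expect H φ').re + (U - E) * (star φ' ⬝ᵥ φ').re = 2 * (star φ' ⬝ᵥ w).re := by
    rw [← Summit.HubbardSuperconductivity.EnslavedA1g.re_two_smul_dotProduct, h2v, dotProduct_add,
      dotProduct_sub, dotProduct_smul, dotProduct_smul, Complex.add_re, Complex.sub_re, smul_eq_mul,
      smul_eq_mul, Complex.re_ofReal_mul, Complex.re_ofReal_mul]
    simp only [Literature.MathematicalPhysics.QuantumLattice.expect]
    ring
  -- (c) the infrared bound at `v = P_s φ`; (d) Cauchy–Schwarz; (e) a priori bound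
  have hIRφ := hIR φ' hφ'mem
  obtain ⟨nu, nv, hnu, hnv, ha, hb, hCS⟩ := exists_norms_re_star_dotProduct_le φ' w
  have hnv2 : nv ^ 2 ≤ (c₀ * (L : ℝ) ^ 2) ^ 2 := by
    have h := re_star_pairField_mulVec_self_le extendedSWave L φ
    rw [hφ1, Complex.one_re, mul_one] at h
    rwa [hb] at h
  have hnvle : nv ≤ c₀ * (L : ℝ) ^ 2 := by
    have h0 : 0 ≤ c₀ * (L : ℝ) ^ 2 := by positivity
    exact (pow_le_pow_iff_left₀ hnv h0 two_ne_zero).1 hnv2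
  have hS2 : (nu ^ 2) ^ 2 ≤ A * (2 * (star φ' ⬝ᵥ w).re) := by
    rw [← hbr, ← ha]
    have hnn : 0 ≤ (star φ' ⬝ᵥ φ').re := by rw [ha]; exact sq_nonneg nu
    exact (pow_le_pow_left₀ hnn (Complex.re_le_norm _) 2).trans hIRφ
  have hB : nu ^ 4 ≤ (2 * A * c₀ * (L : ℝ) ^ 2) * nu := by
    have hle : (star φ' ⬝ᵥ w).re ≤ nu * (c₀ * (L : ℝ) ^ 2) :=
      hCS.trans (mul_le_mul_of_nonneg_left hnvle hnu)
    calc nu ^ 4 = (nu ^ 2) ^ 2 := by ring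
      _ ≤ A * (2 * (star φ' ⬝ᵥ w).re) := hS2
      _ ≤ A * (2 * (nu * (c₀ * (L : ℝ) ^ 2))) :=
          mul_le_mul_of_nonneg_left (mul_le_mul_of_nonneg_left hle zero_le_two) hA
      _ = (2 * A * c₀ * (L : ℝ) ^ 2) * nu := by ring
  rw [ha]
  calc (nu ^ 2) ^ 3 ≤ (2 * A * c₀ * (L : ℝ) ^ 2) ^ 2 := sq_pow_three_le_of_pow_four_le hnu hB
    _ = 4 * c₀ ^ 2 * A ^ 2 * (L : ℝ) ^ 4 := by ring

/-- **`o(L⁴)` U-shifted pair-removal susceptibility ⟹ the crux `NoOnsiteODLRO` (by name, conditional on `hχ`).**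
The fixed-side engine `falkBruch_fixedSide` (prefactor-uniform, constant `K₀ = 4 c₀²`) is fed the
little-`o` infrared bound `hχ`: for every admissible
sequence and every `ε > 0`, eventually in even `L`, `|⟨v, P_s ψ_L⟩|² ≤ ε L⁴ · Re⟨v, K₋ v⟩` on the
pair-removed sector. Conclusion: `S_L / L⁴ ≤ ε` eventually (choose `ε' ≤ 1` with `K₀ ε'² ≤ ε³`, then
`S_L³ ≤ K₀ ε'² L¹² ≤ (ε L⁴)³`). [folklore] -/
theorem NoOnsiteODLRO_of_littleO_susceptibility
    (hχ : ∀ (U δ : ℝ), 0 < U → δ ∈ Set.Ioo (0 : ℝ) (1 / 2) →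
      ∀ (N : ℕ → ℕ) (ψ : ∀ L, Fock (Orb (FermionTorus 2 L))),
        (∀ L, Even L → N L = 2 * ⌊(1 - δ) * (L : ℝ) ^ 2 / 2⌋₊ ∧ star (ψ L) ⬝ᵥ ψ L = 1 ∧
            IsGroundStateInSector (hubbardTorus 2 L 1 U) (N L) 0 (ψ L)) →
          ∀ ε : ℝ, 0 < ε → ∃ L₀ : ℕ, ∀ (L : ℕ) [NeZero L], Even L → L₀ ≤ L →
            ∀ v : Fock (Orb (FermionTorus 2 L)), v ∈ szSector (Λ := FermionTorus 2 L) (N L - 2) 0 →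
              ‖star v ⬝ᵥ ((pairField sWave L) *ᵥ (ψ L))‖ ^ 2 ≤
                ε * (L : ℝ) ^ 4 *
                  ((expect (hubbardTorus 2 L 1 U) v).re +
                    (U - (hubbardTorus 2 L 1 U).minEnergyOn (szSector (Λ := FermionTorus 2 L) (N L) 0)) *
                      (star v ⬝ᵥ v).re)) :
    Summit.HubbardSuperconductivity.HubbardSuperconductivity.Theses.LiebTwin.NoOnsiteODLRO := by
  intro U δ hU hδ N ψ hyp ε hε
  -- the engine constant `K₀ = 4 c₀²`
  set K₀ : ℝ := 4 * (∑ e ∈ insert (0 : Site 2) unitSteps, ‖((extendedSWave e / Real.sqrt 2 : ℝ) : ℂ)‖ * 2) ^ 2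
    with hK₀def
  have hK₀ : 0 ≤ K₀ := by positivity
  -- the auxiliary tolerance `ε' = min 1 ε ^ 3 / (K₀ + 1)` : `ε' ≤ 1` and `K₀ ε'² ≤ (min 1 ε)³ ≤ ε³`
  set μ : ℝ := min 1 ε with hμdef
  have hμpos : 0 < μ := lt_min one_pos hε
  have hμ1 : μ ≤ 1 := min_le_left _ _
  have hμε : μ ≤ ε := min_le_right _ _
  have hK1 : 0 < K₀ + 1 := by linarith
  set ε' : ℝ := μ ^ 3 / (K₀ + 1) with hε'def
  have hε'pos : 0 < ε' := div_pos (pow_pos hμpos 3) hK1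
  have hμ3 : μ ^ 3 ≤ 1 := pow_le_one₀ hμpos.le hμ1
  have hε'1 : ε' ≤ 1 := by
    rw [hε'def, div_le_one hK1]
    linarith
  have hKε : K₀ * ε' ^ 2 ≤ μ ^ 3 := by
    have h1 : ε' ^ 2 ≤ ε' := by nlinarith
    calc K₀ * ε' ^ 2 ≤ (K₀ + 1) * ε' := by nlinarith
      _ = μ ^ 3 := by rw [hε'def]; field_simp
  obtain ⟨L₀, hL₀⟩ := hχ U δ hU hδ N ψ hyp ε' hε'pos
  refine ⟨L₀ + 3, fun L _ hEv hL => ?_⟩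
  obtain ⟨hN, hψ1, hGS⟩ := hyp L hEv
  have hL3 : 3 ≤ L := by omega
  -- `2 ≤ N L`
  have hN2 : 2 ≤ N L := by
    rw [hN]
    have hδ1 : 1 / 2 < 1 - δ := by linarith [hδ.2]
    have hL3' : (3 : ℝ) ≤ L := by exact_mod_cast hL3
    have hL9 : (9 : ℝ) ≤ (L : ℝ) ^ 2 := by nlinarith [hL3']
    have h1 : ((1 : ℕ) : ℝ) ≤ (1 - δ) * (L : ℝ) ^ 2 / 2 := by
      rw [Nat.cast_one, le_div_iff₀ (by norm_num : (0 : ℝ) < 2)]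
      nlinarith
    have h1' : 1 ≤ ⌊(1 - δ) * (L : ℝ) ^ 2 / 2⌋₊ := Nat.le_floor h1
    omega
  -- the engine at prefactor `A = ε' L⁴`
  have hA : 0 ≤ ε' * (L : ℝ) ^ 4 := by positivity
  have hS3 : (expect ((pairField sWave L)ᴴ * pairField sWave L) (ψ L)).re ^ 3 ≤
      K₀ * (ε' * (L : ℝ) ^ 4) ^ 2 * (L : ℝ) ^ 4 :=
    falkBruch_fixedSide hL3 U hN2 hψ1 hGS hA (hL₀ L hEv (by omega))
  have hLpos : (0 : ℝ) < (L : ℝ) := by exact_mod_cast (show 0 < L by omega)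
  have hL4 : (0 : ℝ) < (L : ℝ) ^ 4 := by positivity
  rw [div_le_iff₀ hL4]
  refine le_of_pow_le_pow_left₀ (n := 3) (by norm_num) (by positivity) ?_
  calc (expect ((pairField sWave L)ᴴ * pairField sWave L) (ψ L)).re ^ 3
      ≤ K₀ * (ε' * (L : ℝ) ^ 4) ^ 2 * (L : ℝ) ^ 4 := hS3
    _ = (K₀ * ε' ^ 2) * (L : ℝ) ^ 12 := by ring
    _ ≤ μ ^ 3 * (L : ℝ) ^ 12 := mul_le_mul_of_nonneg_right hKε (by positivity)
    _ ≤ ε ^ 3 * (L : ℝ) ^ 12 :=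
        mul_le_mul_of_nonneg_right (pow_le_pow_left₀ hμpos.le hμε 3) (by positivity)
    _ = (ε * (L : ℝ) ^ 4) ^ 3 := by ring

/-- **Converse, modulo a strict pair chemical-potential window.** If along every admissible sequence the
window `κ_L = U - (E_{N_L} - E_{N_L-2})` is eventually bounded below by some `κ₀ > 0` (`hW`, open) and the
crux `NoOnsiteODLRO` holds (`hS`), then the little-`o` infrared bound of
`NoOnsiteODLRO_of_littleO_susceptibility` holds: for `v` in the pair-removed sector,
`|⟨v, P_sψ_L⟩|² ≤ ‖v‖² S_L ≤ ‖v‖² (εκ₀) L⁴ ≤ ε L⁴ · Re⟨v, K₋ v⟩`, using Cauchy–Schwarz, the crux with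
tolerance `εκ₀`, and the variational principle `Re⟨v, K₋ v⟩ ≥ κ_L ‖v‖² ≥ κ₀ ‖v‖²` in the sector
`(N_L - 2, 0)`. Together with the previous theorem: GIVEN a strict window, the crux is EQUIVALENT to the
`o(L⁴)` U-shifted susceptibility bound — the line `registered` cannot reduce the crux to anything weaker.
[folklore] -/
theorem littleO_susceptibility_of_noOnsiteODLRO
    (hW : ∀ (U δ : ℝ), 0 < U → δ ∈ Set.Ioo (0 : ℝ) (1 / 2) →
      ∀ (N : ℕ → ℕ) (ψ : ∀ L, Fock (Orb (FermionTorus 2 L))),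
        (∀ L, Even L → N L = 2 * ⌊(1 - δ) * (L : ℝ) ^ 2 / 2⌋₊ ∧ star (ψ L) ⬝ᵥ ψ L = 1 ∧
            IsGroundStateInSector (hubbardTorus 2 L 1 U) (N L) 0 (ψ L)) →
          ∃ κ₀ : ℝ, 0 < κ₀ ∧ ∃ L₀ : ℕ, ∀ (L : ℕ) [NeZero L], Even L → L₀ ≤ L →
            κ₀ ≤ U - ((hubbardTorus 2 L 1 U).minEnergyOn (szSector (Λ := FermionTorus 2 L) (N L) 0) -
              (hubbardTorus 2 L 1 U).minEnergyOn (szSector (Λ := FermionTorus 2 L) (N L - 2) 0)))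
    (hS : Summit.HubbardSuperconductivity.HubbardSuperconductivity.Theses.LiebTwin.NoOnsiteODLRO) :
    ∀ (U δ : ℝ), 0 < U → δ ∈ Set.Ioo (0 : ℝ) (1 / 2) →
      ∀ (N : ℕ → ℕ) (ψ : ∀ L, Fock (Orb (FermionTorus 2 L))),
        (∀ L, Even L → N L = 2 * ⌊(1 - δ) * (L : ℝ) ^ 2 / 2⌋₊ ∧ star (ψ L) ⬝ᵥ ψ L = 1 ∧
            IsGroundStateInSector (hubbardTorus 2 L 1 U) (N L) 0 (ψ L)) →
          ∀ ε : ℝ, 0 < ε → ∃ L₀ : ℕ, ∀ (L : ℕ) [NeZero L], Even L → L₀ ≤ L →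
            ∀ v : Fock (Orb (FermionTorus 2 L)), v ∈ szSector (Λ := FermionTorus 2 L) (N L - 2) 0 →
              ‖star v ⬝ᵥ ((pairField sWave L) *ᵥ (ψ L))‖ ^ 2 ≤
                ε * (L : ℝ) ^ 4 *
                  ((expect (hubbardTorus 2 L 1 U) v).re +
                    (U - (hubbardTorus 2 L 1 U).minEnergyOn (szSector (Λ := FermionTorus 2 L) (N L) 0)) *
                      (star v ⬝ᵥ v).re) := by
  intro U δ hU hδ N ψ hyp ε hε
  obtain ⟨κ₀, hκ₀, L₁, hW'⟩ := hW U δ hU hδ N ψ hyp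
  obtain ⟨L₂, hS'⟩ := hS U δ hU hδ N ψ hyp (ε * κ₀) (mul_pos hε hκ₀)
  refine ⟨L₁ + L₂ + 3, fun L _ hEv hL v hv => ?_⟩
  obtain ⟨hN, _hψ1, _hGS⟩ := hyp L hEv
  have hL3 : 3 ≤ L := by omega
  set H := hubbardTorus 2 L 1 U with hHdef
  set E : ℝ := H.minEnergyOn (szSector (Λ := FermionTorus 2 L) (N L) 0) with hEdef
  set E' : ℝ := H.minEnergyOn (szSector (Λ := FermionTorus 2 L) (N L - 2) 0) with hE'def
  set φ' := pairField sWave L *ᵥ ψ L with hφ'def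
  have hκ : κ₀ ≤ U - (E - E') := hW' L hEv (by omega)
  -- the crux with tolerance `ε κ₀` at this side
  have hLpos : (0 : ℝ) < (L : ℝ) := by exact_mod_cast (show 0 < L by omega)
  have hL4 : (0 : ℝ) < (L : ℝ) ^ 4 := by positivity
  have hSle : (star φ' ⬝ᵥ φ').re ≤ ε * κ₀ * (L : ℝ) ^ 4 := by
    have h := hS' L hEv (by omega)
    rw [div_le_iff₀ hL4, PosSemidefTrace.expect_conjTranspose_mul] at h
    exact h
  -- `N L - 2 = 2 k` and the variational principle in the pair-removed sector
  obtain ⟨k, hk⟩ : ∃ k : ℕ, N L - 2 = 2 * k := ⟨⌊(1 - δ) * (L : ℝ) ^ 2 / 2⌋₊ - 1, by rw [hN]; omega⟩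
  have hkcard : k ≤ Fintype.card (FermionTorus 2 L) := by
    rw [card_fermionTorus]
    have h1 : N L ≤ L ^ 2 := by
      rw [hN]
      have hδ0 : 0 < δ := hδ.1
      have hfl : (⌊(1 - δ) * (L : ℝ) ^ 2 / 2⌋₊ : ℝ) ≤ (1 - δ) * (L : ℝ) ^ 2 / 2 :=
        Nat.floor_le (by nlinarith [sq_nonneg (L : ℝ), hδ.2])
      have h2 : (2 * ⌊(1 - δ) * (L : ℝ) ^ 2 / 2⌋₊ : ℝ) ≤ (L : ℝ) ^ 2 := by
        nlinarith [sq_nonneg (L : ℝ)]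
      exact_mod_cast h2
    omega
  have hvsec : IsInSector k k v := by
    rw [hk] at hv
    exact (mem_szSector_two_mul_zero_iff k v).1 hv
  have hvar : E' * (star v ⬝ᵥ v).re ≤ (expect H v).re := by
    have h := (szSector_groundState (fermionTorusGraph 2 L) 1 U hkcard).2 v hvsec
    rw [hE'def, hk]
    exact h
  -- assemble
  have hvv : 0 ≤ (star v ⬝ᵥ v).re := (Complex.nonneg_iff.mp (dotProduct_star_self_nonneg _)).1
  have hbr : κ₀ * (star v ⬝ᵥ v).re ≤ (expect H v).re + (U - E) * (star v ⬝ᵥ v).re := by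
    have h1 : κ₀ * (star v ⬝ᵥ v).re ≤ (U - (E - E')) * (star v ⬝ᵥ v).re :=
      mul_le_mul_of_nonneg_right hκ hvv
    nlinarith
  calc ‖star v ⬝ᵥ φ'‖ ^ 2 ≤ (star v ⬝ᵥ v).re * (star φ' ⬝ᵥ φ').re := norm_star_dotProduct_sq_le v φ'
    _ ≤ (star v ⬝ᵥ v).re * (ε * κ₀ * (L : ℝ) ^ 4) := mul_le_mul_of_nonneg_left hSle hvv
    _ = ε * (L : ℝ) ^ 4 * (κ₀ * (star v ⬝ᵥ v).re) := by ring
    _ ≤ ε * (L : ℝ) ^ 4 * ((expect H v).re + (U - E) * (star v ⬝ᵥ v).re) :=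
        mul_le_mul_of_nonneg_left hbr (by positivity)

/-- REGISTERED SUB-GOAL `stub_littleOSusceptibilityGlue` (crux stmt-HubbardSuperconductivity-0933, line
`registered`): the little-`o` `U`-shifted susceptibility bound implies the BODY of the crux `NoOnsiteODLRO`
verbatim (by-name version: `NoOnsiteODLRO_of_littleO_susceptibility`). [folklore] -/
theorem stub_littleOSusceptibilityGlue : (∀ (U δ : ℝ), 0 < U → δ ∈ Set.Ioo (0 : ℝ) (1 / 2) → ∀ (N : ℕ → ℕ) (ψ : ∀ L, Fock (Orb (FermionTorus 2 L))), (∀ L, Even L → N L = 2 * ⌊(1 - δ) * (L : ℝ) ^ 2 / 2⌋₊ ∧ star (ψ L) ⬝ᵥ ψ L = 1 ∧ IsGroundStateInSector (hubbardTorus 2 L 1 U) (N L) 0 (ψ L)) → ∀ ε : ℝ, 0 < ε → ∃ L₀ : ℕ, ∀ (L : ℕ) [NeZero L], Even L → L₀ ≤ L → ∀ v : Fock (Orb (FermionTorus 2 L)), v ∈ szSector (Λ := FermionTorus 2 L) (N L - 2) 0 → ‖star v ⬝ᵥ ((pairField sWave L) *ᵥ (ψ L))‖ ^ 2 ≤ ε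 * (L : ℝ) ^ 4 * ((expect (hubbardTorus 2 L 1 U) v).re + (U - (hubbardTorus 2 L 1 U).minEnergyOn (szSector (Λ := FermionTorus 2 L) (N L) 0)) * (star v ⬝ᵥ v).re)) → ∀ (U δ : ℝ), 0 < U → δ ∈ Set.Ioo (0 : ℝ) (1 / 2) → ∀ (N : ℕ → ℕ) (ψ : ∀ L, Fock (Orb (FermionTorus 2 L))), (∀ L, Even L → N L = 2 * ⌊(1 - δ) * (L : ℝ) ^ 2 / 2⌋₊ ∧ star (ψ L) ⬝ᵥ ψ L = 1 ∧ IsGroundStateInSector (hubbardTorus 2 L 1 U) (N L) 0 (ψ L)) → ∀ ε : ℝ, 0 < ε → ∃ L₀ : ℕ, ∀ (L : ℕ) [NeZero L], Even L → L₀ ≤ L → (expect (Matrix.conjTranspose (pairField sWave L) * pairField sWave L) (ψ L)).re / (L : ℝ) ^ 4 ≤ ε :=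
  fun hχ => NoOnsiteODLRO_of_littleO_susceptibility hχ

end Summit.HubbardSuperconductivity.NoOnsiteODLRO.Birth

end
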